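import Summits.CriticalPhenomena.PercolationContinuityZ3.Theorems.PercNearOneGluingNoHeavyLowerTailSahiGridPatternBlockOrAssoc

/-!
# `NoHeavyLowerTail` (crux stmt-CriticalPhenomena-4575), Sahi programme P1: **ASSOCIATIVITY OF THE BLOCK-OR VECTOR AT THE LEVEL OF VECTORS ON `[3]^{n+(m+k)}`, AND THE
# TRANSFER OF CONDITION (N)** — the two-step recursive certificate of `(S ⊕ T) ⊕ V` IS the one-step block-OR vector of `S` against the inner block
# `(T ⊕ V, OR8(d_T; V, d_V))`; hence it satisfies (N) for `S ⊕ (T ⊕ V)` as soon as that one-step vector does (OR-universality is closed under block-OR)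

Support file (Sahi cell, seat `prim-sahi-p1`, generation 35; `--supports stmt-CriticalPhenomena-4575`).  Pure proofs, no definitions, no `sorry`, standard axioms.
Sequel of `…BlockOrAssoc` (the polynomial identity `blockOr_value_assoc`); vocabulary of `…CellForm` (`glue`, `freeOf`, `cellOf`), `…BlockOrT` (`ind_glue_blockOr`, `nuCount_blockOr`).

THE MATHEMATICS (seat memo FROM-prim-sahi-p1-gen35 §1 (U4)).  Work on `[3]^{n+(m+k)}`; a point `x` has outer part `a = freeOf x ∈ [3]^n` and inner part `cellOf x ∈ [3]^{m+k}`
with `b = freeOf (cellOf x)`, `c = cellOf (cellOf x)`.  Blocks `S ⊆ [3]^n`, `T ⊆ [3]^m`, `V ⊆ [3]^k` with vectors `d_S, d_T, d_V`; `W = T ⊕ V ⊆ [3]^{m+k}`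
(`glue b c ∈ W ↔ b ∈ T ∨ c ∈ V`).  The LEFT-NESTED vector `L(x)` = "OR8 of the block `(S⊕T, OR8(d_S;T,d_T))` against `(V,d_V)`", written in the point data of `x`
(outer indicator `s+t−st`, outer count `2^mν_S+2^nν_T−ν_Sν_T` — these ARE `1_{S⊕T}`, `ν_{S⊕T}` by `ind_glue_blockOr`, `nuCount_blockOr` — and outer value
`e(a,b) = OR8(d_S;T,d_T)(glue a b)`), equals the RIGHT-NESTED vector `R(x)` = the `…BlockOrT` expression of `OR8(d_S; W, f)` with `f = OR8(d_T;V,d_V)` on `[3]^{m+k}`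
(**`blockOr_assoc_apply`**).  Consequently (**`diagCert_blockOr_assoc_N`**): if `R` satisfies (N) for a first slot `A ⊆ [3]^{n+(m+k)}` then so does `L` — in the use
case `A = S ⊕ W = (S⊕T)⊕V` the hypothesis is OR-universality of `d_S` applied to the certified inner block `(W, f)` (itself certified by universality of `d_T`), so the
recursive certificate of an OR node whose children carry universal certificates is universal (memo (U4)).  ((T) needs no transfer: it holds for every block-OR vector
of blocks satisfying (T), `diagCert_blockOr_T`.)  Nothing here asserts universality of any particular certificate, Conjecture RO, or `PatternPos d` for `d ≥ 4`. [this work]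
-/

namespace Summit.CriticalPhenomena.PercolationContinuityZ3.Theorems.SahiGridPattern

open Finset SahiGrid3
open scoped BigOperators

variable {n m k : ℕ} {S : Finset (Pd n)} {T : Finset (Pd m)} {V : Finset (Pd k)} {W : Finset (Pd (m + k))}

/-- **Vector-level associativity** (`L(x) = R(x)`, see the file header; `W = T ⊕ V`). [this work] -/
theorem blockOr_assoc_apply (hW : ∀ η z, glue η z ∈ W ↔ (η ∈ T ∨ z ∈ V)) (dS : Pd n → ℤ) (dT : Pd m → ℤ) (dV : Pd k → ℤ) (x : Pd (n + (m + k))) :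
(ind S (freeOf x) + ind T (freeOf (cellOf x)) - ind S (freeOf x) * ind T (freeOf (cellOf x))) * ind V (cellOf (cellOf x)) * ((2:ℤ) ^ (n + (m + k)) + (2 ^ (n + m) * (ind S (freeOf
          x) + ind T (freeOf (cellOf x)) - ind S (freeOf x) * ind T (freeOf (cellOf x))) - (2 ^ m * (nuCount S (freeOf x) : ℤ) + 2 ^ n * (nuCount T (freeOf (cellOf x)) : ℤ) -
          (nuCount S (freeOf x) : ℤ) * (nuCount T (freeOf (cellOf x)) : ℤ))) * (2 ^ k * ind V (cellOf (cellOf x)) - (nuCount V (cellOf (cellOf x)) : ℤ))) + (ind S (freeOf x) + ind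
          T (freeOf (cellOf x)) - ind S (freeOf x) * ind T (freeOf (cellOf x))) * (1 - ind V (cellOf (cellOf x))) * (2 ^ k * (ind S (freeOf x) * ind T (freeOf (cellOf x)) * ((2:ℤ)
          ^ (n + m) + (2 ^ n * ind S (freeOf x) - (nuCount S (freeOf x) : ℤ)) * (2 ^ m * ind T (freeOf (cellOf x)) - (nuCount T (freeOf (cellOf x)) : ℤ))) + ind S (freeOf x) * (1 -
          ind T (freeOf (cellOf x))) * (2 ^ m * dS (freeOf x) - (2 ^ n * ind S (freeOf x) - (nuCount S (freeOf x) : ℤ)) * (nuCount T (freeOf (cellOf x)) : ℤ)) + (1 - ind S (freeOf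
          x)) * ind T (freeOf (cellOf x)) * (2 ^ m * (nuCount S (freeOf x) : ℤ) + (2 ^ n - (nuCount S (freeOf x) : ℤ)) * dT (freeOf (cellOf x)))) - (2 ^ (n + m) * (ind S (freeOf x)
          + ind T (freeOf (cellOf x)) - ind S (freeOf x) * ind T (freeOf (cellOf x))) - (2 ^ m * (nuCount S (freeOf x) : ℤ) + 2 ^ n * (nuCount T (freeOf (cellOf x)) : ℤ) - (nuCount
          S (freeOf x) : ℤ) * (nuCount T (freeOf (cellOf x)) : ℤ))) * (nuCount V (cellOf (cellOf x)) : ℤ)) + (1 - (ind S (freeOf x) + ind T (freeOf (cellOf x)) - ind S (freeOf x) *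
          ind T (freeOf (cellOf x)))) * ind V (cellOf (cellOf x)) * (2 ^ k * (2 ^ m * (nuCount S (freeOf x) : ℤ) + 2 ^ n * (nuCount T (freeOf (cellOf x)) : ℤ) - (nuCount S (freeOf
          x) : ℤ) * (nuCount T (freeOf (cellOf x)) : ℤ)) + (2 ^ (n + m) - (2 ^ m * (nuCount S (freeOf x) : ℤ) + 2 ^ n * (nuCount T (freeOf (cellOf x)) : ℤ) - (nuCount S (freeOf x)
          : ℤ) * (nuCount T (freeOf (cellOf x)) : ℤ))) * dV (cellOf (cellOf x)))
= ind S (freeOf x) * ind W (cellOf x) * ((2:ℤ) ^ (n + (m + k)) + (2 ^ n * ind S (freeOf x) - (nuCount S (freeOf x) : ℤ)) * (2 ^ (m + k) * ind W (cellOf x) - (nuCount W (cellOf x) :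
            ℤ))) + ind S (freeOf x) * (1 - ind W (cellOf x)) * (2 ^ (m + k) * dS (freeOf x) - (2 ^ n * ind S (freeOf x) - (nuCount S (freeOf x) : ℤ)) * (nuCount W (cellOf x) : ℤ))
            + (1 - ind S (freeOf x)) * ind W (cellOf x) * (2 ^ (m + k) * (nuCount S (freeOf x) : ℤ) + (2 ^ n - (nuCount S (freeOf x) : ℤ)) * (fun q : Pd (m + k) => ind T (freeOf q)
            * ind V (cellOf q) * ((2:ℤ) ^ (m + k) + (2 ^ m * ind T (freeOf q) - (nuCount T (freeOf q) : ℤ)) * (2 ^ k * ind V (cellOf q) - (nuCount V (cellOf q) : ℤ))) + ind T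
            (freeOf q) * (1 - ind V (cellOf q)) * (2 ^ k * dT (freeOf q) - (2 ^ m * ind T (freeOf q) - (nuCount T (freeOf q) : ℤ)) * (nuCount V (cellOf q) : ℤ)) + (1 - ind T
            (freeOf q)) * ind V (cellOf q) * (2 ^ k * (nuCount T (freeOf q) : ℤ) + (2 ^ m - (nuCount T (freeOf q) : ℤ)) * dV (cellOf q))) (cellOf x)) := by
  have hq : cellOf x = glue (freeOf (cellOf x)) (cellOf (cellOf x)) := (glue_freeOf_cellOf (cellOf x)).symm
  have hindW : ind W (cellOf x) = ind T (freeOf (cellOf x)) + ind V (cellOf (cellOf x)) - ind T (freeOf (cellOf x)) * ind V (cellOf (cellOf x)) := by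
    rw [hq, ind_glue_blockOr hW, freeOf_glue, cellOf_glue]
  have hnuW : (nuCount W (cellOf x) : ℤ) = 2 ^ k * (nuCount T (freeOf (cellOf x)) : ℤ) + 2 ^ m * (nuCount V (cellOf (cellOf x)) : ℤ)
      - (nuCount T (freeOf (cellOf x)) : ℤ) * (nuCount V (cellOf (cellOf x)) : ℤ) := by
    rw [hq, nuCount_blockOr hW, freeOf_glue, cellOf_glue]
  rw [hindW, hnuW]
  have h := blockOr_value_assoc n m k (ind S (freeOf x)) (ind T (freeOf (cellOf x))) (ind V (cellOf (cellOf x)))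
    (nuCount S (freeOf x) : ℤ) (nuCount T (freeOf (cellOf x)) : ℤ) (nuCount V (cellOf (cellOf x)) : ℤ) (dS (freeOf x)) (dT (freeOf (cellOf x))) (dV (cellOf (cellOf x)))
    (ind_eq_zero_or_one S _) (ind_eq_zero_or_one T _) (ind_eq_zero_or_one V _)
  simp only at h
  have hpow : (2:ℤ) ^ (n + m + k) = 2 ^ (n + (m + k)) := by rw [Nat.add_assoc]
  rw [hpow] at h
  simp only
  linarith [h]

/-- **Transfer of condition (N) along associativity.**  If the right-nested vector `OR8(d_S; W, f)` (`W = T ⊕ V`, `f = OR8(d_T;V,d_V)`) satisfies (N) for a first slot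
`A ⊆ [3]^{n+(m+k)}`, then so does the left-nested vector (the two-step recursive certificate of `(S⊕T)⊕V`). [this work] -/
theorem diagCert_blockOr_assoc_N {A : Finset (Pd (n + (m + k)))} (hW : ∀ η z, glue η z ∈ W ↔ (η ∈ T ∨ z ∈ V)) (dS : Pd n → ℤ) (dT : Pd m → ℤ) (dV : Pd k → ℤ)
    (hN : ∀ P Q : Finset (Pd (n + (m + k))), IsUpperSet (P : Set (Pd (n + (m + k)))) → IsUpperSet (Q : Set (Pd (n + (m + k)))) →
      (∑ x ∈ P, ∑ y ∈ Q, thetaVal A x y) ≤ ∑ x ∈ P ∩ Q,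
(ind S (freeOf x) * ind W (cellOf x) * ((2:ℤ) ^ (n + (m + k)) + (2 ^ n * ind S (freeOf x) - (nuCount S (freeOf x) : ℤ)) * (2 ^ (m + k) * ind W (cellOf x) - (nuCount W (cellOf x) :
              ℤ))) + ind S (freeOf x) * (1 - ind W (cellOf x)) * (2 ^ (m + k) * dS (freeOf x) - (2 ^ n * ind S (freeOf x) - (nuCount S (freeOf x) : ℤ)) * (nuCount W (cellOf x) :
              ℤ)) + (1 - ind S (freeOf x)) * ind W (cellOf x) * (2 ^ (m + k) * (nuCount S (freeOf x) : ℤ) + (2 ^ n - (nuCount S (freeOf x) : ℤ)) * (fun q : Pd (m + k) => ind T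
              (freeOf q) * ind V (cellOf q) * ((2:ℤ) ^ (m + k) + (2 ^ m * ind T (freeOf q) - (nuCount T (freeOf q) : ℤ)) * (2 ^ k * ind V (cellOf q) - (nuCount V (cellOf q) : ℤ)))
              + ind T (freeOf q) * (1 - ind V (cellOf q)) * (2 ^ k * dT (freeOf q) - (2 ^ m * ind T (freeOf q) - (nuCount T (freeOf q) : ℤ)) * (nuCount V (cellOf q) : ℤ)) + (1 -
              ind T (freeOf q)) * ind V (cellOf q) * (2 ^ k * (nuCount T (freeOf q) : ℤ) + (2 ^ m - (nuCount T (freeOf q) : ℤ)) * dV (cellOf q))) (cellOf x))))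
    {P Q : Finset (Pd (n + (m + k)))} (hP : IsUpperSet (P : Set (Pd (n + (m + k))))) (hQ : IsUpperSet (Q : Set (Pd (n + (m + k))))) :
    (∑ x ∈ P, ∑ y ∈ Q, thetaVal A x y) ≤ ∑ x ∈ P ∩ Q,
((ind S (freeOf x) + ind T (freeOf (cellOf x)) - ind S (freeOf x) * ind T (freeOf (cellOf x))) * ind V (cellOf (cellOf x)) * ((2:ℤ) ^ (n + (m + k)) + (2 ^ (n + m) * (ind S (freeOf
            x) + ind T (freeOf (cellOf x)) - ind S (freeOf x) * ind T (freeOf (cellOf x))) - (2 ^ m * (nuCount S (freeOf x) : ℤ) + 2 ^ n * (nuCount T (freeOf (cellOf x)) : ℤ) -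
            (nuCount S (freeOf x) : ℤ) * (nuCount T (freeOf (cellOf x)) : ℤ))) * (2 ^ k * ind V (cellOf (cellOf x)) - (nuCount V (cellOf (cellOf x)) : ℤ))) + (ind S (freeOf x) +
            ind T (freeOf (cellOf x)) - ind S (freeOf x) * ind T (freeOf (cellOf x))) * (1 - ind V (cellOf (cellOf x))) * (2 ^ k * (ind S (freeOf x) * ind T (freeOf (cellOf x)) *
            ((2:ℤ) ^ (n + m) + (2 ^ n * ind S (freeOf x) - (nuCount S (freeOf x) : ℤ)) * (2 ^ m * ind T (freeOf (cellOf x)) - (nuCount T (freeOf (cellOf x)) : ℤ))) + ind S (freeOf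
            x) * (1 - ind T (freeOf (cellOf x))) * (2 ^ m * dS (freeOf x) - (2 ^ n * ind S (freeOf x) - (nuCount S (freeOf x) : ℤ)) * (nuCount T (freeOf (cellOf x)) : ℤ)) + (1 -
            ind S (freeOf x)) * ind T (freeOf (cellOf x)) * (2 ^ m * (nuCount S (freeOf x) : ℤ) + (2 ^ n - (nuCount S (freeOf x) : ℤ)) * dT (freeOf (cellOf x)))) - (2 ^ (n + m) *
            (ind S (freeOf x) + ind T (freeOf (cellOf x)) - ind S (freeOf x) * ind T (freeOf (cellOf x))) - (2 ^ m * (nuCount S (freeOf x) : ℤ) + 2 ^ n * (nuCount T (freeOf (cellOf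
            x)) : ℤ) - (nuCount S (freeOf x) : ℤ) * (nuCount T (freeOf (cellOf x)) : ℤ))) * (nuCount V (cellOf (cellOf x)) : ℤ)) + (1 - (ind S (freeOf x) + ind T (freeOf (cellOf
            x)) - ind S (freeOf x) * ind T (freeOf (cellOf x)))) * ind V (cellOf (cellOf x)) * (2 ^ k * (2 ^ m * (nuCount S (freeOf x) : ℤ) + 2 ^ n * (nuCount T (freeOf (cellOf x))
            : ℤ) - (nuCount S (freeOf x) : ℤ) * (nuCount T (freeOf (cellOf x)) : ℤ)) + (2 ^ (n + m) - (2 ^ m * (nuCount S (freeOf x) : ℤ) + 2 ^ n * (nuCount T (freeOf (cellOf x)) :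
            ℤ) - (nuCount S (freeOf x) : ℤ) * (nuCount T (freeOf (cellOf x)) : ℤ))) * dV (cellOf (cellOf x)))) := by
  refine le_trans (hN P Q hP hQ) (le_of_eq (Finset.sum_congr rfl fun x _ => ?_))
  exact (blockOr_assoc_apply hW dS dT dV x).symm

end Summit.CriticalPhenomena.PercolationContinuityZ3.Theorems.SahiGridPattern
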